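import Summits.QuantumFields.YangMills.Theorems.PencilRigidityDiagonalMirrorRPRCentreReduction

/-! # StrategistR1Pieces — BC2 / decomposition probes for crux `DiagonalMirrorRPR` (stmt-QuantumFields-10604), strategist r1

Pieces of the only typed decompositions available (sign / coupling-class splits and the transport):
* `DW`    — the weak-coupling slice (what every route consumes);
* `DnotW` — the complement slice (bounded / negative / oscillating / non-divergent couplings);
* `TW`    — weak-coupling cover transport ("package upgrade": W₁ + weak coupling ⇒ tilted-cover convergence to the same S₁);
* `Tplus` — the registered residual T⁺ (`CoverInsensitivityOffDiag` under couplings ≥ 0 at every step).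
Assemblies `D_of_slices : DW → DnotW → D` and `DW_of_TW : TW → DW` are PROVED below; the probes must all FAIL / be CLEAN. -/

set_option autoImplicit false

noncomputable section

open scoped SchwartzMap
open MeasureTheory Filter Topology
open Literature.MathematicalPhysics.QuantumLattice Literature.MathematicalPhysics.AQFT
  Literature.MathematicalPhysics.QuantumFieldTheory

namespace Summit.QuantumFields.YangMills.Cruxes.DiagonalMirrorRPR.StrategistR1

open ParityBridgeColdTraces

/-- weak-coupling slice -/
def DW : Prop :=
  ∀ (G : Type) [Group G] [TopologicalSpace G] [IsTopologicalGroup G] [CompactSpace G],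
    IsCompactSimpleLieGroup G →
      letI : MeasurableSpace G := borel G
      haveI : BorelSpace G := ⟨rfl⟩
      ∀ (r : LatticeRep G) (sch : SpeciesScheme (YMSpecies G)) (S₁ : SchwingerFamily E4),
        CurvaturePackage r sch S₁ → sch.HasWeakCouplingLimit → DiagonalFrameRP S₁

/-- complement slice -/
def DnotW : Prop :=
  ∀ (G : Type) [Group G] [TopologicalSpace G] [IsTopologicalGroup G] [CompactSpace G],
    IsCompactSimpleLieGroup G →
      letI : MeasurableSpace G := borel G
      haveI : BorelSpace G := ⟨rfl⟩
      ∀ (r : LatticeRep G) (sch : SpeciesScheme (YMSpecies G)) (S₁ : SchwingerFamily E4),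
        CurvaturePackage r sch S₁ → ¬ sch.HasWeakCouplingLimit → DiagonalFrameRP S₁

/-- weak-coupling transport (package-upgrade form) -/
def TW : Prop :=
  ∀ (G : Type) [Group G] [TopologicalSpace G] [IsTopologicalGroup G] [CompactSpace G],
    IsCompactSimpleLieGroup G →
      letI : MeasurableSpace G := borel G
      haveI : BorelSpace G := ⟨rfl⟩
      ∀ (r : LatticeRep G) (sch : SpeciesScheme (YMSpecies G)) (S₁ : SchwingerFamily E4),
        CurvaturePackage r sch S₁ → sch.HasWeakCouplingLimit →
          ∀ (n : ℕ), n ≠ 0 → ∀ (f : Fin n → 𝓢(E4, ℝ)) (F : 𝓢((Fin n → E4), ℂ)),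
            IsTensorOf F (fun i => ofRealTest (f i)) → IsOffDiagonal F →
              Tendsto (fun k : ℕ =>
                ((tiltedLatticeSchwinger r.ρ sch (fun s => s.F) k n (fun _ => r.curvature) f : ℝ) : ℂ))
                atTop (𝓝 (S₁ n F))

/-- registered residual T⁺ -/
def Tplus : Prop :=
  ∀ (G : Type) [Group G] [TopologicalSpace G] [IsTopologicalGroup G] [CompactSpace G]
    [MeasurableSpace G] [BorelSpace G], IsCompactSimpleLieGroup G →
    ∀ (r : LatticeRep G) (sch : SpeciesScheme (YMSpecies G)) (S₁ : SchwingerFamily E4),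
      CurvaturePackage r sch S₁ → (∀ k, 0 ≤ sch.β k) → CoverInsensitivityOffDiag r sch

/-- assembly of the slice split (pure logic) -/
theorem D_of_slices (hW : DW) (hN : DnotW) :
    Summit.QuantumFields.YangMills.Theses.PencilRigidity.DiagonalMirrorRPR := by
  intro G _ _ _ _ hG
  letI : MeasurableSpace G := borel G
  haveI : BorelSpace G := ⟨rfl⟩
  intro W₁ r sch S₁ hP
  by_cases h : sch.HasWeakCouplingLimit
  · exact hW G hG r sch S₁ hP h
  · exact hN G hG r sch S₁ hP h

/-- the weak-coupling slice from the weak-coupling transport (landed v3) -/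
theorem DW_of_TW (hT : TW) : DW := by
  intro G _ _ _ _ hG
  letI : MeasurableSpace G := borel G
  haveI : BorelSpace G := ⟨rfl⟩
  intro r sch S₁ hP hw
  exact CentreTwistedSwap.Reduction.restatedCruxWeakCoupling_holds G hG r sch S₁ hP hw (hT G hG r sch S₁ hP hw)

end Summit.QuantumFields.YangMills.Cruxes.DiagonalMirrorRPR.StrategistR1

end

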